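import Mathlib
import Summits.Ventures.PercRepro.TriangleCapThreeBelowOneTriangleD

/-!
# PercRepro — THREE BELOW THE DIAGONAL, ONE TRIANGLE, NO OUTER VERTEX, PART E: THE CELL `(11, 25)` (p3, gen 38;
part 110)

The residue analysis of parts C–D widened to the cell `(11, 25)` (`a = 4`, `m = 3k − 8`): in the non-Mantel case
`2 (ab + bc + ca) < 2n + e` with `n = 8`, `e = 14` gives `ab + bc + ca ≤ 14 = 2n − 2`, and for `n ≥ 8` that already
forces two private sets of total size `≤ 2` (`partition_small_of_sigma_lt'`: `(3, 5)` has `15`), whereupon the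
residue of part D applies (there `e ≤ 2n − 4 = 12 < 14`, a contradiction inside the residue).
**`one_triangle_stability_three_no_outer'`**: the theorem of part D with the third alternative `k ≥ 11` and
`2m ≤ 6k − 16`.  Axioms: standard.
-/

namespace PercRepro

namespace TriangleCap

namespace C047

open Finset

variable {V : Type*} [Fintype V] [DecidableEq V]

omit [Fintype V] [DecidableEq V] in
/-- A partition `a + b + c = n` with `ab + bc + ca ≤ 2n − 4` and `n ≥ 6`, or with `ab + bc + ca < 2n` and `n ≥ 9`,
or with `ab + bc + ca ≤ 2n − 2` and `n ≥ 8`, has two parts of total size at most `2`. -/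
theorem partition_small_of_sigma_lt' (a b c n : ℕ) (h : a + b + c = n)
    (hsig : (a * b + b * c + c * a + 4 ≤ 2 * n ∧ 6 ≤ n) ∨ (a * b + b * c + c * a < 2 * n ∧ 9 ≤ n) ∨
      (a * b + b * c + c * a + 2 ≤ 2 * n ∧ 8 ≤ n)) :
    b + c ≤ 2 ∨ a + c ≤ 2 ∨ a + b ≤ 2 := by
  by_contra hcon
  push Not at hcon
  obtain ⟨h1, h2, h3⟩ := hcon
  -- every pair sum is `≥ 3`: if some part is `0` the other two are `≥ 3`, else at most one part is `1`
  rcases Nat.eq_zero_or_pos a with ha | ha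
  · subst ha
    have hb : 3 ≤ b := by omega
    have hc : 3 ≤ c := by omega
    have : 3 * (n - 3) ≤ b * c := by
      obtain ⟨b', hb'⟩ : ∃ b', b = b' + 3 := ⟨b - 3, by omega⟩
      obtain ⟨c', hc'⟩ : ∃ c', c = c' + 3 := ⟨c - 3, by omega⟩
      subst hb' hc'
      have : n - 3 = b' + c' + 3 := by omega
      rw [this]
      nlinarith
    rcases hsig with ⟨hs, hn⟩ | ⟨hs, hn⟩ | ⟨hs, hn⟩ <;> omega
  rcases Nat.eq_zero_or_pos b with hb | hb
  · subst hb
    have ha3 : 3 ≤ a := by omega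
    have hc : 3 ≤ c := by omega
    have : 3 * (n - 3) ≤ c * a := by
      obtain ⟨a', ha'⟩ : ∃ a', a = a' + 3 := ⟨a - 3, by omega⟩
      obtain ⟨c', hc'⟩ : ∃ c', c = c' + 3 := ⟨c - 3, by omega⟩
      subst ha' hc'
      have : n - 3 = a' + c' + 3 := by omega
      rw [this]
      nlinarith
    rcases hsig with ⟨hs, hn⟩ | ⟨hs, hn⟩ | ⟨hs, hn⟩ <;> omega
  rcases Nat.eq_zero_or_pos c with hc | hc
  · subst hc
    have ha3 : 3 ≤ a := by omega
    have hb3 : 3 ≤ b := by omega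
    have : 3 * (n - 3) ≤ a * b := by
      obtain ⟨a', ha'⟩ : ∃ a', a = a' + 3 := ⟨a - 3, by omega⟩
      obtain ⟨b', hb'⟩ : ∃ b', b = b' + 3 := ⟨b - 3, by omega⟩
      subst ha' hb'
      have : n - 3 = a' + b' + 3 := by omega
      rw [this]
      nlinarith
    rcases hsig with ⟨hs, hn⟩ | ⟨hs, hn⟩ | ⟨hs, hn⟩ <;> omega
  -- all parts positive: a part equal to `1` leaves two parts `≥ 2` whose product is `≥` their sum (`+ 2` when the
  -- sum is `≥ 8`); otherwise `ab + bc + ca ≥ 2 (a + b + c) = 2n`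
  have key : ∀ p q : ℕ, 2 ≤ p → 2 ≤ q → p + q ≤ p * q ∧ (7 ≤ p + q → p + q + 2 ≤ p * q) := by
    intro p q hp hq
    obtain ⟨p', hp'⟩ : ∃ p', p = p' + 2 := ⟨p - 2, by omega⟩
    obtain ⟨q', hq'⟩ : ∃ q', q = q' + 2 := ⟨q - 2, by omega⟩
    subst hp' hq'
    have e : (p' + 2) * (q' + 2) = p' * q' + 2 * p' + 2 * q' + 4 := by ring
    rw [e]
    omega
  rcases Nat.lt_or_ge a 2 with ha1 | ha2
  · have ha1' : a = 1 := by omega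
    subst ha1'
    obtain ⟨k1, k2⟩ := key b c (by omega) (by omega)
    rcases hsig with ⟨hs, hn⟩ | ⟨hs, hn⟩ | ⟨hs, hn⟩
    · omega
    · have := k2 (by omega)
      omega
    · have := k2 (by omega)
      omega
  rcases Nat.lt_or_ge b 2 with hb1 | hb2
  · have hb1' : b = 1 := by omega
    subst hb1'
    obtain ⟨k1, k2⟩ := key c a (by omega) (by omega)
    rcases hsig with ⟨hs, hn⟩ | ⟨hs, hn⟩ | ⟨hs, hn⟩
    · omega
    · have := k2 (by omega)
      omega
    · have := k2 (by omega)
      omega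
  rcases Nat.lt_or_ge c 2 with hc1 | hc2
  · have hc1' : c = 1 := by omega
    subst hc1'
    obtain ⟨k1, k2⟩ := key a b (by omega) (by omega)
    rcases hsig with ⟨hs, hn⟩ | ⟨hs, hn⟩ | ⟨hs, hn⟩
    · omega
    · have := k2 (by omega)
      omega
    · have := k2 (by omega)
      omega
  have h2a : a * 2 ≤ a * b := Nat.mul_le_mul_left a hb2
  have h2b : b * 2 ≤ b * c := Nat.mul_le_mul_left b hc2
  have h2c : c * 2 ≤ c * a := Nat.mul_le_mul_left c ha2
  rcases hsig with ⟨hs, hn⟩ | ⟨hs, hn⟩ | ⟨hs, hn⟩ <;> omega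

/-- **THREE BELOW THE DIAGONAL, ONE TRIANGLE, NO OUTER VERTEX, WIDENED:** `K₄⁻`-free, the only triangle `u v w`,
every vertex off it adjacent to one of `u, v, w`, `k ≥ 9`, `2m ≥ 6k − 24`, `2m ≠ 6k − 20`, and `k ≥ 12` or
`2m = 6k − 24` or (`k ≥ 11` and `2m ≤ 6k − 16`) ⇒ `Σ_v d(v)² + 3 (k − 4) ≤ m k`. -/
theorem one_triangle_stability_three_no_outer' (D : SimpleGraph V) [DecidableRel D.Adj] (hK : K4mFree D)
    {u v w : V} (huv : D.Adj u v) (huw : D.Adj u w) (hvw : D.Adj v w)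
    (hT : ∀ a b c, D.Adj a b → D.Adj a c → D.Adj b c → a = u ∨ a = v ∨ a = w)
    (hq : ∀ z, z ∉ ({u, v, w} : Finset V) → 1 ≤ degIn D {u, v, w} z)
    (hk : 9 ≤ Fintype.card V) (hm : 6 * Fintype.card V ≤ 2 * D.edgeFinset.card + 24)
    (hm' : 2 * D.edgeFinset.card + 20 ≠ 6 * Fintype.card V)
    (hA : 12 ≤ Fintype.card V ∨ 2 * D.edgeFinset.card + 24 = 6 * Fintype.card V ∨
      (11 ≤ Fintype.card V ∧ 2 * D.edgeFinset.card + 16 ≤ 6 * Fintype.card V)) :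
    ∑ v, deg D v * deg D v + 3 * (Fintype.card V - 4) ≤ D.edgeFinset.card * Fintype.card V := by
  obtain ⟨-, -, hQle, hdens⟩ := one_triangle_no_outer_count D hK huv huw hvw hT hq
  by_cases hlarge : 4 * (({u, v, w} : Finset V)ᶜ).card +
      ∑ z ∈ ({u, v, w} : Finset V)ᶜ, degIn D ({u, v, w} : Finset V)ᶜ z +
      2 * ∑ x ∈ ({u, v, w} : Finset V), degIn D ({u, v, w} : Finset V)ᶜ x * degIn D ({u, v, w} : Finset V)ᶜ x ≤
      2 * ((({u, v, w} : Finset V)ᶜ).card * (({u, v, w} : Finset V)ᶜ).card)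
  · exact one_triangle_stability_three_no_outer_of_large D hK huv huw hvw hT hq (by omega) hlarge
  push Not at hlarge
  set S : Finset V := {u, v, w} with hS
  have h3 : S.card = 3 := card_triple huv.ne huw.ne hvw.ne
  have hk' : Fintype.card V = Sᶜ.card + 3 := by
    have := card_add_card_compl S
    omega
  have hs1 : ∀ z ∈ Sᶜ, degIn D S z = 1 := by
    intro z hz
    have h1 : degIn D S z ≤ 1 := degIn_le_one_of_triangle D hK huv huw hvw (mem_compl.mp hz)
    have h2 : 1 ≤ degIn D S z := hq z (mem_compl.mp hz)
    omega
  have hsum1 : ∑ z ∈ Sᶜ, degIn D S z = Sᶜ.card := by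
    rw [sum_congr rfl hs1, sum_const, smul_eq_mul, mul_one]
  have hcomm := sum_degIn_comm D S Sᶜ
  rw [hsum1] at hcomm
  have huvw : u ∉ ({v, w} : Finset V) := by
    simp only [mem_insert, mem_singleton, not_or]; exact ⟨huv.ne, huw.ne⟩
  have hvw' : v ∉ ({w} : Finset V) := by simp only [mem_singleton]; exact hvw.ne
  have e_sum : ∑ x ∈ S, degIn D Sᶜ x = degIn D Sᶜ u + (degIn D Sᶜ v + degIn D Sᶜ w) := by
    rw [hS, sum_insert huvw, sum_insert hvw', sum_singleton]
  have e_sq : ∑ x ∈ S, degIn D Sᶜ x * degIn D Sᶜ x =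
      degIn D Sᶜ u * degIn D Sᶜ u + (degIn D Sᶜ v * degIn D Sᶜ v + degIn D Sᶜ w * degIn D Sᶜ w) := by
    rw [hS, sum_insert huvw, sum_insert hvw', sum_singleton]
  rw [e_sum] at hcomm
  rw [e_sq] at hlarge hQle
  set a := degIn D Sᶜ u with ha
  set b := degIn D Sᶜ v with hb
  set c := degIn D Sᶜ w with hc
  set n := Sᶜ.card with hn
  set Q' := ∑ z ∈ Sᶜ, degIn D Sᶜ z with hQ'
  have hnn : n * n = a * a + (b * b + c * c) + 2 * (a * b + b * c + c * a) := by
    rw [← hcomm]; ring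
  have hsig : (a * b + b * c + c * a + 4 ≤ 2 * n ∧ 6 ≤ n) ∨ (a * b + b * c + c * a < 2 * n ∧ 9 ≤ n) ∨
      (a * b + b * c + c * a + 2 ≤ 2 * n ∧ 8 ≤ n) := by
    rcases hA with hA | hA | ⟨hA1, hA2⟩
    · right; left
      constructor
      · omega
      · omega
    · left
      constructor
      · omega
      · omega
    · right; right
      constructor
      · omega
      · omega
  have hn6 : 6 ≤ n := by omega
  rcases partition_small_of_sigma_lt' a b c n (by omega) hsig with h | h | h
  · exact one_triangle_stability_three_no_outer_residue D hK huv huw hvw hT hq hn6 hm hm' h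
  · obtain ⟨-, -, p3, -, -⟩ := triple_perm (a := u) (b := v) (c := w)
    have hT' : ∀ a b c, D.Adj a b → D.Adj a c → D.Adj b c → a = v ∨ a = u ∨ a = w := by
      intro a b c h1 h2 h3
      rcases hT a b c h1 h2 h3 with h | h | h
      · exact Or.inr (Or.inl h)
      · exact Or.inl h
      · exact Or.inr (Or.inr h)
    have hq' : ∀ z, z ∉ ({v, u, w} : Finset V) → 1 ≤ degIn D {v, u, w} z := by
      rw [p3]; exact hq
    have hn' : 6 ≤ (({v, u, w} : Finset V)ᶜ).card := by rw [p3]; exact hn6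
    have h' : degIn D ({v, u, w} : Finset V)ᶜ u + degIn D ({v, u, w} : Finset V)ᶜ w ≤ 2 := by
      rw [p3]; exact h
    exact one_triangle_stability_three_no_outer_residue D hK huv.symm hvw huw hT' hq' hn' hm hm' h'
  · obtain ⟨-, p2, -, -, -⟩ := triple_perm (a := u) (b := v) (c := w)
    have hT' : ∀ a b c, D.Adj a b → D.Adj a c → D.Adj b c → a = w ∨ a = u ∨ a = v := by
      intro a b c h1 h2 h3
      rcases hT a b c h1 h2 h3 with h | h | h
      · exact Or.inr (Or.inl h)
      · exact Or.inr (Or.inr h)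
      · exact Or.inl h
    have hq' : ∀ z, z ∉ ({w, u, v} : Finset V) → 1 ≤ degIn D {w, u, v} z := by
      rw [p2]; exact hq
    have hn' : 6 ≤ (({w, u, v} : Finset V)ᶜ).card := by rw [p2]; exact hn6
    have h' : degIn D ({w, u, v} : Finset V)ᶜ u + degIn D ({w, u, v} : Finset V)ᶜ v ≤ 2 := by
      rw [p2]; exact h
    exact one_triangle_stability_three_no_outer_residue D hK huw.symm hvw.symm huv hT' hq' hn' hm hm' h'

end C047

end TriangleCap

end PercRepro
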